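import Summits.BirchSwinnertonDyer.Rank1Residual.X11b.Three.ZhangAtThree
import HarnessLib

/-!
# TYPED CONJECTURE Z₃′ (cell `bsd-stepL`, seat `bsd-stepL-koly`; memo `koly/MEMO-v2.md` §6.2,
# lemmas W1–W3 `koly/Z3PRIME-W123.md`, referee g5 PASS `referee/VERDICT-KOLY-MEMO-v2-g5.md` §C) —
# Z₃ (`Three.Koly.ZhangAtThree`, same directory) with the ALL-RAMIFIED hypothesis (iii) DROPPED

FILED per the planner's ruling (R-o) (TARGET.md v1.11 §1.2: "referee W1–W3 PASS ⇒ tree twin like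
p397481; `ZhangAtThree` never edited in place"). HONEST FRAMING: `ZhangAtThreePrime` is a
hypothesis-shaped `Prop`; NOTHING asserts it; `@[conjecture]`. The two theorems below say only:
(1) Z₃′ implies Z₃ (Z₃ has MORE hypotheses — bookkeeping), and (2) IF Z₃′ holds then STEP L
(`X11b.IndexLowerBoundAt W 3 K y_K`) follows from the McCallum fact exactly as for Z₃
(`exists_indexLowerBoundAt_three_of_zhangAtThree_of_mccallum`). Nothing is booked; the memo-level
proof chain of Z₃/Z₃′ (MEMO-v2, referee PASS as a chain with named conditions (c1)–(c4)) is NOT a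
kernel object.

Why (iii) can be dropped (memo §6.2; W1–W3, refereed): on the locus `3 ∤ ∏ c_ℓ` the only
multiplicative `ℓ ≠ 3` at which (iii) "3 ∤ v_ℓ(Δ_min)" can fail are NON-SPLIT multiplicative primes
(a split one has `c_ℓ = v_ℓ(Δ_min)`), and there (W1) the local condition is `H¹ = 0` (`ℓ ≡ 1 (3)`)
or the `V`-determined toric line (`ℓ ≡ 2 (3)`), (W2) the Tamagawa exponent `t(A_m/ℚ_ℓ) = 0`
(Frobenius acts by `−1` on the component group), (W3) no other use — EXCEPT that the chain needs
ONE multiplicative `ℓ₀ ≠ 3` with `ρ̄` ramified (Skinner 2016 Thm B (ii); the Ribet–Takahashi /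
Pollack–Weston step), so (iv) is strengthened to the census bit Ram. Census of record on this
statement (TARGET §2a, K-Z3′, two engines): U3 locus 810 → 906 of 1 116 A1 cells; class-wide
145 268 → 177 754 (71.4 % of A1 below 5·10⁵).
-/

noncomputable section

open scoped Classical

namespace Summit.BirchSwinnertonDyer.Rank1Residual.X11b.Three.Koly

open WeierstrassCurve Literature.NumberTheory.EllipticCurves
  Literature.NumberTheory.EllipticCurves.ModularForms

/-- **Conjecture Z₃′ (typed; NOT asserted)** — `ZhangAtThree` (W. Zhang 2014 Thm 1.1 / Skinner–Zhang
2014 Thm 1.3 moved to `p = 3 ∥ N`) with the all-ramified hypothesis (iii) REMOVED and (iv)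
strengthened to Ram: `∃ ℓ₀ ≠ 3` multiplicative with `3 ∤ v_{ℓ₀}(Δ_min)`. Binders otherwise verbatim
those of `ZhangAtThree`: `3 ∥ N`; `ρ̄_{E,3}` onto; `3 ∤ v₃(Δ_min)`; split-3 `𝓛`-clause; `3 ∤ ∏ c_ℓ`;
`K` imaginary quadratic, Heegner for `N_E`, `d_K ≠ -3`. CONJECTURE (hypothesis-shaped `Prop`,
nothing asserted; cell bsd-stepL, seat koly; memo MEMO-v2 §6.2, referee g5 PASS of W1–W3).
[cite: WZhang2014, Thm. 1.1 (p. 195) with "p ≥ 5 ordinary, p ∤ N" replaced by "p = 3 ∥ N" — NOT printed at p = 3 (shape only; nothing asserted)]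
[cite: McCallumLMS1991, §5 Cor. 5.6 (p. 310) — the consumer's bridge] -/
@[conjecture] def ZhangAtThreePrime (W : WeierstrassCurve ℚ) [W.IsElliptic] [W.IsGloballyMinimal]
    [NeZero (W.conductorNorm ℤ)] (K : Type) [Field K] [NumberField K] : Prop :=
  W.HasMultiplicativeReductionAtPrime 3 →
  W.HasSurjectiveModNGaloisRep 3 →
  ¬ 3 ∣ padicValInt 3 W.minimalDiscriminantInt →
  (W.HasSplitMultiplicativeReductionAtPrime 3 →
    ∀ D : TateParameterData W 3, (padicLog 3 D.q).valuation = 1) →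
  (∃ (ℓ : ℕ) (_ : Fact ℓ.Prime), ℓ ≠ 3 ∧ W.HasMultiplicativeReductionAtPrime ℓ ∧
      ¬ 3 ∣ padicValInt ℓ W.minimalDiscriminantInt) →
  ¬ 3 ∣ W.tamagawaProduct →
  IsImaginaryQuadratic K → SatisfiesHeegnerHypothesis (W.conductorNorm ℤ) K →
  NumberField.discr K ≠ -3 →
  ∃ (Dt : ModularParametrizationData W (W.conductorNorm ℤ)) (β : ℤ) (ι : K →+* ℂ) (n : ℕ)
    (d : KolyvaginHeegnerData Dt β ι n),
    KolyvaginDescent.KolSupp (Zhang2014.IsKolyvaginPrime (W.conductorNorm ℤ) W K 3) n ∧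
      d.kolyvaginClass Nat.prime_three 1 ≠ 0

/-- **Z₃′ implies Z₃**: under Z₃'s hypotheses (iii) + (iv) the Ram clause of Z₃′ holds, so the
weaker-hypothesis statement gives the stronger-hypothesis one (bookkeeping only; nothing asserted
about either conjecture). [folklore] -/
theorem zhangAtThree_of_zhangAtThreePrime (W : WeierstrassCurve ℚ) [W.IsElliptic]
    [W.IsGloballyMinimal] [NeZero (W.conductorNorm ℤ)] (K : Type) [Field K] [NumberField K]
    (h : ZhangAtThreePrime W K) : ZhangAtThree W K :=
  fun hmult hρ hfin hL hram hmult' htam hK hH h3 ↦ by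
    obtain ⟨ℓ, hℓ, hne, hm⟩ := hmult'
    exact h hmult hρ hfin hL ⟨ℓ, hℓ, hne, hm, hram ℓ hne hm⟩ htam hK hH h3

/-- **Z₃′ ⇒ STEP L at 3** on the larger locus (no all-ramified hypothesis): the same McCallum
consumer as `exists_indexLowerBoundAt_three_of_zhangAtThree_of_mccallum` (its tower-surjectivity
binder discharged by `Rank1Residual.surjective_pow_three_of_mult_of_tateLine`, Wuthrich 2014
Lemma 20). CONDITIONAL on `hMc`; `hZ3' : ZhangAtThreePrime W K` is a HYPOTHESIS (open).
[cite: McCallumLMS1991, §5 Cor. 5.6 (p. 310)] [cite: Wuthrich2014, Lemma 20 (p. 399)] -/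
theorem exists_indexLowerBoundAt_three_of_zhangAtThreePrime_of_mccallum
    (W : WeierstrassCurve ℚ) [W.IsElliptic] [W.IsGloballyMinimal] [NeZero (W.conductorNorm ℤ)]
    (K : Type) [Field K] [NumberField K]
    (hZ3' : ZhangAtThreePrime W K) (hMc : McCallum1991_pow_dvd_card_sha_primary_of_certificate)
    (hmult : W.HasMultiplicativeReductionAtPrime 3) (hρ : W.HasSurjectiveModNGaloisRep 3)
    (hfin3 : ¬ 3 ∣ padicValInt 3 W.minimalDiscriminantInt)
    (hL : W.HasSplitMultiplicativeReductionAtPrime 3 →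
      ∀ D : TateParameterData W 3, (padicLog 3 D.q).valuation = 1)
    (hmult' : ∃ (ℓ : ℕ) (_ : Fact ℓ.Prime), ℓ ≠ 3 ∧ W.HasMultiplicativeReductionAtPrime ℓ ∧
      ¬ 3 ∣ padicValInt ℓ W.minimalDiscriminantInt)
    (htam : ¬ 3 ∣ W.tamagawaProduct)
    (hK : IsImaginaryQuadratic K) (hH : SatisfiesHeegnerHypothesis (W.conductorNorm ℤ) K)
    (h3 : NumberField.discr K ≠ -3) (h4 : NumberField.discr K ≠ -4) (hCM : ¬ W.HasCM)
    (hrank : (W.baseChange K).mordellWeilRank = 1)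
    (hiv : ∀ x : (W.baseChange K).toAffine.Point, 3 • x = 0 → x = 0)
    [Finite (W.baseChange K).sha] :
    ∃ (Dt : ModularParametrizationData W (W.conductorNorm ℤ)) (β : ℤ) (ι : K →+* ℂ),
      ∀ (d₁ : KolyvaginHeegnerData Dt β ι 1) (P : (W.baseChange K).toAffine.Point),
        d₁.toGeomPoints d₁.derivedPoint = toGeomPoints (W.baseChange K) P →
        ¬ IsOfFinAddOrder P →
        ∀ (M₀ : ℕ), (∃ Q : (W.baseChange K).toAffine.Point, ((3 ^ M₀ : ℕ) : ℤ) • Q = P) →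
          (¬ ∃ Q : (W.baseChange K).toAffine.Point, ((3 ^ (M₀ + 1) : ℕ) : ℤ) • Q = P) →
          IndexLowerBoundAt W 3 K P := by
  have hsurj : ∀ m : ℕ, W.HasSurjectiveModNGaloisRep (3 ^ m : ℕ) :=
    Rank1Residual.surjective_pow_three_of_mult_of_tateLine W hmult hρ
  obtain ⟨Dt, β, ι, n, d, hn, hne⟩ := hZ3' hmult hρ hfin3 hL hmult' htam hK hH h3
  exact ⟨Dt, β, ι, fun d₁ P hP hPinf M₀ hdiv hndiv ↦
    indexLowerBoundAt_of_kolyvaginClass_one_ne_zero_of_mccallum W K hMc hCM hK h3 h4 hH 3 (by norm_num)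
      hsurj Dt β ι d₁ P hP hPinf hrank hiv hdiv hndiv d hn hne⟩

end Summit.BirchSwinnertonDyer.Rank1Residual.X11b.Three.Koly

end
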